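import Summits.BirchSwinnertonDyer.BirchSwinnertonDyer.Theorems.RankLeOneBSDpOfGlobalDivisibilityExcessCertificate
import HarnessLib

/-!
# CERTIFICATE currency from the UPPER INDEX SOCKET alone (route-free, any odd prime `p`): co-STEP L
# `ord_p #Ш(E/K) + 2·ord_p ∏_ℓ c_ℓ(E) + 2s ≤ 2·ord_p [E(K):ℤP]` at one imaginary quadratic `K` + FINITE
# certificates (index, `Ш_an`, `p`-descent lower bounds) ⟹ the exact `p`-parts of `Ш(E/ℚ)` and `Ш(E^{d_K}/ℚ)`
# ⟹ `BSD_p(E)` and `BSD_p(E^{d_K})` — whatever RESEARCH input produced the socket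
# (cell `bsd-wall`, D-0131 (3) M-UTD, seat `bsd-wall-utd-p3` gen 2; socket-currency refactor of gen 1's files 4–6)

Gen 1's certificate files (`RankLeOneBSDpOfGlobalDivisibilityCertificate.lean` p546379/p547200,
`…ExcessCertificate.lean` p548538) derive `BSD_p` in referee A's per-class currency from ONE research input
— the Σ-form global divisibility J of the derived Heegner points (SOED crux 20760) read through Matar–Nekovář
— plus finite certificates. The research input enters ONLY through the upper socket
`SchneiderFree.Upper.IndexUpperBoundLeAt W p K P s` (`upper_of_globalDivisibility_of_irr`). Since 2026-08-27
the tree has THREE typed producers of that socket on the additive rows: (J) gen 1's receptacle (J + MN19 /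
McCallum); (I) UTD's inclusion crux 20395 `AdditiveSplitIMCInclusionAtThree` + Waldspurger frame + control
(gen 2, `WildThreeInclusionKernel.indexUpperBoundLeAt_of_additiveSplitIMCInclusionAtThree`, by name, `p = 3`);
(I♭) the ♭-inclusion `(Q) ⊆ Ch_Λ(X_(∅,0))·𝓞_{ℂ_p}⟦T⟧` + Hsieh + LZZ + control (kmc g20,
`UniversalToricDescentWaldspurgerFlat.indexUpperBoundLeAt_of_flatInclGe_of_control`, any odd additive `p`);
and K9's Jetchev readings on the non-surjective rows. THIS FILE states gen 1's certificate theorems with the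
SOCKET as the hypothesis, so that every producer feeds them with no further glue:

* §1 (excess `0`) `padicValNat_shaOrder_eq_zero_of_upper_of_index_le` — socket at slack `s` + index
  certificate `ord_p [E(K):ℤP] ≤ ord_p ∏_ℓ c_ℓ(E) + s` + `Ш(E/K)` finite ⟹ `ord_p #Ш(E/K) = 0 = ord_p #Ш(E/ℚ)`;
  `noPTorsion_sha_of_upper_of_index_le` (`Ш(E/ℚ)[p] = 0`); **`bsdp_of_upper_of_index_le_of_shaAnUnit`** —
  + `r_an(E) ≤ 1` + `#Ш_an(E)` a `p`-adic unit (GZK named) ⟹ `BSDp W p`. NO rank-zero leaf, NO twist.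
* §2 (joint) `padicValNat_shaOrder_add_twist_le_of_upper` — the socket read through
  `#Ш(E/K)[p^∞] = #Ш(E/ℚ)[p^∞]·#Ш(E^{d_K}/ℚ)[p^∞]` (gen 1's `padicValNat_shaOrder_baseChange_eq_add_twist`):
  `ord_p #Ш(E) + ord_p #Ш(E^{d_K}) + 2·ord_p ∏c + 2s ≤ 2·ord_p [E(K):ℤP]`.
* §3 (excess `e`) `padicValNat_shaOrder_eq_of_upper_of_certificates` — index certificate of excess `e` +
  lower certificates `a ≤ ord_p #Ш(E)`, `b ≤ ord_p #Ш(E^{d_K})`, `a + b = 2e` ⟹ equalities;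
  **`bsdp_of_upper_of_excess_certificates`** (`BSDp W p` from `#Ш_an(E) = q`, `ord_p q = a`) and
  **`partner_bsdp_of_upper_of_excess_certificates`** (`BSDp Wd p` for any model `Wd` of the rank-ZERO twist,
  from `#Ш_an(Wd) = qd`, `ord_p qd = b`); `partner_bsdp_of_upper_of_index_le_of_shaAnUnit` (`e = 0`).

PARTITION reading (census `bsd-wall-census/blockA/BLOCK-A-index.md`, READ; onto-W `r_an = 1` residue at `3`:
3 894 classes): with producer (I) or (I♭) every row is ONE inclusion at `E` + ports + finite certificates —
JET-PRODUCT 3 413 (`e = 0`, `Ш_an(E)` `3`-free: §1), TAM3FREE 289 / INDEX-EXCESS 183 / SHA3-AN 9 (§3 with a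
`3`-descent on `E^{d_K}` resp. `E`); and the rank-ZERO wild twists `E^{d_K}` of these rows get `BSD₃` from the
same input (§3 partner). Classes closed: 0; «beyond-print theorem»: NO (the socket's producers are
research-grade). HONEST FRAMING: pure bookkeeping over gen 1's theorems; CONDITIONAL on the socket, the named
facts and the certificates; per datum; books nothing by itself; whether computed certificates are admissible
per-class inputs is the referee desks' call. No definition, no named fact, no `sorry`.
References: [Jetchev2008] Cor. 1.5 and (1) (Compos. Math. 144 (2008) p. 812); [JetchevSkinnerWan2017] §7.4.1
(arXiv:1512.06894 p. 30); [DokchitserDokchitserAnnals2010] Lemma 4.14; [Miller2011LMS] §1, Def. 1.1;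
[GrossLMS1991] Thm. 1.3, Prop. 2.1; [SerreGaloisCohomology1997] I.§2.4.
-/

noncomputable section

open scoped Classical

set_option linter.dupNamespace false
set_option autoImplicit false

namespace Summit.BirchSwinnertonDyer.BirchSwinnertonDyer.Theorems.SchneiderFree.Exact

open WeierstrassCurve NumberField IsDedekindDomain Field
  Literature.NumberTheory.EllipticCurves
  Literature.NumberTheory.EllipticCurves.ModularForms
  Literature.NumberTheory.EllipticCurves.Rank1Residual
  Literature.NumberTheory.EllipticCurves.Rank1Residual.Typed
  Literature.NumberTheory.EllipticCurves.KrizLi2019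
  Summit.BirchSwinnertonDyer.Rank1Residual
  Summit.BirchSwinnertonDyer.Rank1Residual.X11b
  Summit.BirchSwinnertonDyer.Rank1Residual.X11b.Three

/-! ### §1 Excess `0`: `Ш` is `p`-free, `BSD_p(E)` from the analytic certificate -/

/-- **Upper socket + index certificate ⟹ `ord_p #Ш(E/K) = 0` and `ord_p #Ш(E/ℚ) = 0`.** For `W/ℚ`, an odd
prime `p`, `K` imaginary quadratic, any `P ∈ E(K)` and slack `s` with `Upper.IndexUpperBoundLeAt W p K P s`
(`ord_p #Ш(E/K) + 2·ord_p ∏_ℓ c_ℓ(E) + 2s ≤ 2·ord_p [E(K):ℤP]`), the certificate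
`ord_p [E(K):ℤP] ≤ ord_p ∏_ℓ c_ℓ(E) + s` and `Ш(E/K)` finite: the arithmetic `indexBounds_of_upper_of_index_le`
kills `ord_p #Ш(E/K)`, and the restriction `Ш(E/ℚ) → Ш(E/K)` has kernel killed by `[K:ℚ] = 2`
(`padicValNat_shaOrder_le_baseChange_of_odd`). CONDITIONAL on the socket (whatever produced it).
[cite: Jetchev2008, Cor. 1.5 and (1) (p. 812)] [cite: SerreGaloisCohomology1997, I.§2.4 Cor. to Prop. 9] -/
theorem padicValNat_shaOrder_eq_zero_of_upper_of_index_le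
    (W : WeierstrassCurve ℚ) [W.IsElliptic] (K : Type) [Field K] [NumberField K]
    (hK : IsImaginaryQuadratic K) (p : ℕ) [Fact p.Prime] (hp2 : p ≠ 2)
    {P : (W.baseChange K).toAffine.Point} {s : ℕ} (hup : Upper.IndexUpperBoundLeAt W p K P s)
    (hI : padicValNat p (AddSubgroup.zmultiples P).index ≤ padicValNat p W.tamagawaProduct + s)
    (hfinK : (W.baseChange K).ShaFinite) :
    padicValNat p (W.baseChange K).shaOrder = 0 ∧ padicValNat p W.shaOrder = 0 := by
  obtain ⟨hK0, -, -⟩ := indexBounds_of_upper_of_index_le hup hI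
  have hfin : W.ShaFinite := shaFinite_of_baseChange W K hfinK
  have hle : padicValNat p W.shaOrder ≤ padicValNat p (Nat.card (W.baseChange K).sha) :=
    padicValNat_shaOrder_le_baseChange_of_odd W K hK p hp2 hfin hfinK
  have hK0' : padicValNat p (Nat.card (W.baseChange K).sha) = 0 := hK0
  exact ⟨hK0, by omega⟩

/-- **… hence `Ш(E/ℚ)[p] = 0`** (Lagrange). CONDITIONAL on the socket. [cite: Miller2011LMS, Def. 1.1]
[cite: Jetchev2008, Cor. 1.5 (p. 812)] -/
theorem noPTorsion_sha_of_upper_of_index_le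
    (W : WeierstrassCurve ℚ) [W.IsElliptic] (K : Type) [Field K] [NumberField K]
    (hK : IsImaginaryQuadratic K) (p : ℕ) [Fact p.Prime] (hp2 : p ≠ 2)
    {P : (W.baseChange K).toAffine.Point} {s : ℕ} (hup : Upper.IndexUpperBoundLeAt W p K P s)
    (hI : padicValNat p (AddSubgroup.zmultiples P).index ≤ padicValNat p W.tamagawaProduct + s)
    (hfinK : (W.baseChange K).ShaFinite) :
    ∀ x : W.sha, (p : ℤ) • x = 0 → x = 0 :=
  noPTorsion_of_padicValNat_shaOrder_eq_zero W p (shaFinite_of_baseChange W K hfinK)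
    (padicValNat_shaOrder_eq_zero_of_upper_of_index_le W K hK p hp2 hup hI hfinK).2

/-- **`BSD_p(E)` in analytic rank `≤ 1` from the upper socket, the index certificate and `#Ш_an(E)` a
`p`-adic unit** (`#Ш_an(E) = q`, `ord_p q = 0`; GZK named: `Ш(E/ℚ)` finite, rank = analytic rank; Miller's
`BSD(E,p)` with both sides `p`-free). NO twist, NO rank-zero leaf. CONDITIONAL on the socket; per datum;
books nothing by itself. [cite: Miller2011LMS, §1 and Def. 1.1] [cite: GrossLMS1991, Thm. 1.3 and Prop. 2.1]
[cite: Jetchev2008, Cor. 1.5 and (1) (p. 812)] -/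
theorem bsdp_of_upper_of_index_le_of_shaAnUnit (hGZK : rank_eq_analyticRank_of_analyticRank_le_one)
    (W : WeierstrassCurve ℚ) [W.IsElliptic] [W.IsGloballyMinimal] (hr : W.analyticRank ≤ 1)
    (K : Type) [Field K] [NumberField K] (hK : IsImaginaryQuadratic K) (p : ℕ) [Fact p.Prime] (hp2 : p ≠ 2)
    {P : (W.baseChange K).toAffine.Point} {s : ℕ} (hup : Upper.IndexUpperBoundLeAt W p K P s)
    (hI : padicValNat p (AddSubgroup.zmultiples P).index ≤ padicValNat p W.tamagawaProduct + s)
    (hfinK : (W.baseChange K).ShaFinite) {q : ℚ} (hq : shaAn W = (q : ℂ)) (hv : padicValRat p q = 0) :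
    BSDp W p :=
  bsdp_of_shaAn_unit_of_noPTorsion W p hGZK hr hq hv (noPTorsion_sha_of_upper_of_index_le W K hK p hp2 hup hI hfinK)

/-! ### §2 The JOINT bound on `Ш(E/ℚ)` and `Ш(E^{d_K}/ℚ)` from the socket -/

/-- **Upper socket ⟹ `ord_p #Ш(E/ℚ) + ord_p #Ш(E^{d_K}/ℚ) + 2·ord_p ∏_ℓ c_ℓ(E) + 2s ≤ 2·ord_p [E(K):ℤP]`**
(odd `p`, `K` imaginary quadratic, `Wd` any `ℚ`-model of the twist by `d_K`, all three `Ш`'s finite): the socket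
read through gen 1's `padicValNat_shaOrder_baseChange_eq_add_twist` (JSW 2017 §7.4.1 / Dokchitser–Dokchitser
2010 Lemma 4.14). CONDITIONAL on the socket. [cite: JetchevSkinnerWan2017, §7.4.1 (arXiv:1512.06894 p. 30)]
[cite: DokchitserDokchitserAnnals2010, Lemma 4.14] -/
theorem padicValNat_shaOrder_add_twist_le_of_upper
    (W : WeierstrassCurve ℚ) [W.IsElliptic] (K : Type) [Field K] [NumberField K]
    (hK : IsImaginaryQuadratic K) (Wd : WeierstrassCurve ℚ) [Wd.IsElliptic]
    (hC : ∃ C : VariableChange ℚ, C • W.quadraticTwist (NumberField.discr K : ℚ) = Wd)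
    (p : ℕ) [Fact p.Prime] (hp2 : p ≠ 2) [Finite W.sha] [Finite Wd.sha] [Finite (W.baseChange K).sha]
    {P : (W.baseChange K).toAffine.Point} {s : ℕ} (hup : Upper.IndexUpperBoundLeAt W p K P s) :
    padicValNat p W.shaOrder + padicValNat p Wd.shaOrder + 2 * padicValNat p W.tamagawaProduct + 2 * s ≤
      2 * padicValNat p (AddSubgroup.zmultiples P).index := by
  have hsum := padicValNat_shaOrder_baseChange_eq_add_twist W K hK Wd hC p hp2
  unfold Upper.IndexUpperBoundLeAt at hup
  omega

/-! ### §3 Excess `e` and the descent certificates: exact `p`-parts, then `BSD_p` of both curves -/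

/-- **EXACT `p`-parts of `Ш(E/ℚ)` and `Ш(E^{d_K}/ℚ)` from the upper socket + an index certificate of excess `e`
+ two lower certificates.** Odd `p`, `W` with `r_an(E) ≤ 1`, `K` imaginary quadratic with `L(E^{d_K},1) ≠ 0`
(so the twist has analytic rank `0`), `Wd` a `ℚ`-model of the twist, `Ш(E/K)` finite (GZK named: `Ш(E/ℚ)`,
`Ш(E^{d_K}/ℚ)` finite); certificates: `ord_p [E(K):ℤP] ≤ ord_p ∏_ℓ c_ℓ(E) + s + e`, `a ≤ ord_p #Ш(E/ℚ)`,
`b ≤ ord_p #Ш(E^{d_K}/ℚ)`, `a + b = 2e`. Then `ord_p #Ш(E/ℚ) = a` and `ord_p #Ш(E^{d_K}/ℚ) = b`. CONDITIONAL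
on the socket. [cite: Jetchev2008, Cor. 1.5 and (1) (p. 812)] [cite: JetchevSkinnerWan2017, §7.4.1 (arXiv:1512.06894 p. 30)] -/
theorem padicValNat_shaOrder_eq_of_upper_of_certificates (hGZK : rank_eq_analyticRank_of_analyticRank_le_one)
    (W : WeierstrassCurve ℚ) [W.IsElliptic] (hr : W.analyticRank ≤ 1)
    (K : Type) [Field K] [NumberField K] (hK : IsImaginaryQuadratic K) (p : ℕ) [Fact p.Prime] (hp2 : p ≠ 2)
    (Wd : WeierstrassCurve ℚ) [Wd.IsElliptic]
    (hLd : (W.quadraticTwist (NumberField.discr K : ℚ)).entireLFunction 1 ≠ 0)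
    (hC : ∃ C : VariableChange ℚ, C • W.quadraticTwist (NumberField.discr K : ℚ) = Wd)
    (hfinK : (W.baseChange K).ShaFinite)
    {P : (W.baseChange K).toAffine.Point} {s : ℕ} (hup : Upper.IndexUpperBoundLeAt W p K P s)
    {e a b : ℕ} (hI : padicValNat p (AddSubgroup.zmultiples P).index ≤ padicValNat p W.tamagawaProduct + s + e)
    (ha : a ≤ padicValNat p W.shaOrder) (hb : b ≤ padicValNat p Wd.shaOrder) (hab : a + b = 2 * e) :
    padicValNat p W.shaOrder = a ∧ padicValNat p Wd.shaOrder = b := by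
  haveI : Finite (W.baseChange K).sha := hfinK
  haveI : Finite W.sha := (hGZK W hr).2
  obtain ⟨Cd, hCd⟩ := hC
  have hD0 : (NumberField.discr K : ℚ) ≠ 0 := by exact_mod_cast NumberField.discr_ne_zero K
  haveI : (W.quadraticTwist (NumberField.discr K : ℚ)).IsElliptic := W.isElliptic_quadraticTwist hD0
  have hLd1 : Wd.entireLFunction 1 ≠ 0 := by rw [← hCd, entireLFunction_smul]; exact hLd
  have hrd : Wd.analyticRank = 0 := analyticRank_eq_zero_of_entireLFunction_one_ne_zero Wd hLd1
  haveI : Finite Wd.sha := (hGZK Wd (by rw [hrd]; exact zero_le_one)).2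
  have hJ := padicValNat_shaOrder_add_twist_le_of_upper W K hK Wd ⟨Cd, hCd⟩ p hp2 hup
  omega

/-- **`BSD_p(E)` from the upper socket + certificates (INDEX-EXCESS / SHA-AN shape).** Data as in
`padicValNat_shaOrder_eq_of_upper_of_certificates`, `W` globally minimal; certificates: index excess `e`,
lower bounds `a`, `b` with `a + b = 2e`, and `#Ш_an(E) = q` with `ord_p q = a`. Then `BSDp W p`. NO rank-zero
leaf. CONDITIONAL on the socket; per datum; books nothing by itself. [cite: Miller2011LMS, Def. 1.1]
[cite: Jetchev2008, Cor. 1.5 and (1) (p. 812)] [cite: GrossLMS1991, Thm. 1.3 and Prop. 2.1] -/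
theorem bsdp_of_upper_of_excess_certificates (hGZK : rank_eq_analyticRank_of_analyticRank_le_one)
    (W : WeierstrassCurve ℚ) [W.IsElliptic] [W.IsGloballyMinimal] (hr : W.analyticRank ≤ 1)
    (K : Type) [Field K] [NumberField K] (hK : IsImaginaryQuadratic K) (p : ℕ) [Fact p.Prime] (hp2 : p ≠ 2)
    (Wd : WeierstrassCurve ℚ) [Wd.IsElliptic]
    (hLd : (W.quadraticTwist (NumberField.discr K : ℚ)).entireLFunction 1 ≠ 0)
    (hC : ∃ C : VariableChange ℚ, C • W.quadraticTwist (NumberField.discr K : ℚ) = Wd)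
    (hfinK : (W.baseChange K).ShaFinite)
    {P : (W.baseChange K).toAffine.Point} {s : ℕ} (hup : Upper.IndexUpperBoundLeAt W p K P s)
    {e a b : ℕ} (hI : padicValNat p (AddSubgroup.zmultiples P).index ≤ padicValNat p W.tamagawaProduct + s + e)
    (ha : a ≤ padicValNat p W.shaOrder) (hb : b ≤ padicValNat p Wd.shaOrder) (hab : a + b = 2 * e)
    {q : ℚ} (hq : shaAn W = (q : ℂ)) (hv : padicValRat p q = a) :
    BSDp W p := by
  obtain ⟨hWa, -⟩ := padicValNat_shaOrder_eq_of_upper_of_certificates hGZK W hr K hK p hp2 Wd hLd hC hfinK hup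
    hI ha hb hab
  exact bsdp_of_missingPPartAt W p hGZK hr ⟨q, hq, by rw [hv, hWa]⟩

/-- **`BSD_p(E^{d_K})` — the rank-ZERO twist, any globally minimal model `Wd` — from the upper socket of its
rank-`≤ 1` partner + certificates**, the analytic certificate on the twist's side: `#Ш_an(Wd) = qd`,
`ord_p qd = b`. CONDITIONAL on the socket; per datum. [cite: Miller2011LMS, Def. 1.1]
[cite: JetchevSkinnerWan2017, §7.4.1 (arXiv:1512.06894 p. 30)] [cite: Jetchev2008, Cor. 1.5 and (1) (p. 812)] -/
theorem partner_bsdp_of_upper_of_excess_certificates (hGZK : rank_eq_analyticRank_of_analyticRank_le_one)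
    (W : WeierstrassCurve ℚ) [W.IsElliptic] (hr : W.analyticRank ≤ 1)
    (K : Type) [Field K] [NumberField K] (hK : IsImaginaryQuadratic K) (p : ℕ) [Fact p.Prime] (hp2 : p ≠ 2)
    (Wd : WeierstrassCurve ℚ) [Wd.IsElliptic] [Wd.IsGloballyMinimal]
    (hLd : (W.quadraticTwist (NumberField.discr K : ℚ)).entireLFunction 1 ≠ 0)
    (hC : ∃ C : VariableChange ℚ, C • W.quadraticTwist (NumberField.discr K : ℚ) = Wd)
    (hfinK : (W.baseChange K).ShaFinite)
    {P : (W.baseChange K).toAffine.Point} {s : ℕ} (hup : Upper.IndexUpperBoundLeAt W p K P s)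
    {e a b : ℕ} (hI : padicValNat p (AddSubgroup.zmultiples P).index ≤ padicValNat p W.tamagawaProduct + s + e)
    (ha : a ≤ padicValNat p W.shaOrder) (hb : b ≤ padicValNat p Wd.shaOrder) (hab : a + b = 2 * e)
    {qd : ℚ} (hqd : shaAn Wd = (qd : ℂ)) (hvd : padicValRat p qd = b) :
    BSDp Wd p := by
  obtain ⟨-, hWb⟩ := padicValNat_shaOrder_eq_of_upper_of_certificates hGZK W hr K hK p hp2 Wd hLd hC hfinK hup
    hI ha hb hab
  -- the twist has analytic rank `0`
  obtain ⟨Cd, hCd⟩ := hC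
  have hD0 : (NumberField.discr K : ℚ) ≠ 0 := by exact_mod_cast NumberField.discr_ne_zero K
  haveI : (W.quadraticTwist (NumberField.discr K : ℚ)).IsElliptic := W.isElliptic_quadraticTwist hD0
  have hLd1 : Wd.entireLFunction 1 ≠ 0 := by rw [← hCd, entireLFunction_smul]; exact hLd
  have hrd : Wd.analyticRank = 0 := analyticRank_eq_zero_of_entireLFunction_one_ne_zero Wd hLd1
  exact bsdp_of_missingPPartAt Wd p hGZK (by rw [hrd]; exact zero_le_one) ⟨qd, hqd, by rw [hvd, hWb]⟩

/-- **`BSD_p(E^{d_K})` on the excess-`0` shape** (`e = a = b = 0`: index certificate `ord_p [E(K):ℤP] ≤ ord_p ∏c + s`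
and `#Ш_an(Wd)` a `p`-adic unit) — the rank-ZERO twist of a JET-exact rank-one datum is paid by its partner's
upper socket. CONDITIONAL on the socket; per datum. [cite: Miller2011LMS, Def. 1.1]
[cite: Jetchev2008, Cor. 1.5 and (1) (p. 812)] -/
theorem partner_bsdp_of_upper_of_index_le_of_shaAnUnit (hGZK : rank_eq_analyticRank_of_analyticRank_le_one)
    (W : WeierstrassCurve ℚ) [W.IsElliptic] (hr : W.analyticRank ≤ 1)
    (K : Type) [Field K] [NumberField K] (hK : IsImaginaryQuadratic K) (p : ℕ) [Fact p.Prime] (hp2 : p ≠ 2)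
    (Wd : WeierstrassCurve ℚ) [Wd.IsElliptic] [Wd.IsGloballyMinimal]
    (hLd : (W.quadraticTwist (NumberField.discr K : ℚ)).entireLFunction 1 ≠ 0)
    (hC : ∃ C : VariableChange ℚ, C • W.quadraticTwist (NumberField.discr K : ℚ) = Wd)
    (hfinK : (W.baseChange K).ShaFinite)
    {P : (W.baseChange K).toAffine.Point} {s : ℕ} (hup : Upper.IndexUpperBoundLeAt W p K P s)
    (hI : padicValNat p (AddSubgroup.zmultiples P).index ≤ padicValNat p W.tamagawaProduct + s)
    {qd : ℚ} (hqd : shaAn Wd = (qd : ℂ)) (hvd : padicValRat p qd = 0) :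
    BSDp Wd p :=
  partner_bsdp_of_upper_of_excess_certificates hGZK W hr K hK p hp2 Wd hLd hC hfinK hup (e := 0) (a := 0)
    (b := 0) (by simpa using hI) (Nat.zero_le _) (Nat.zero_le _) rfl hqd (by simpa using hvd)

end Summit.BirchSwinnertonDyer.BirchSwinnertonDyer.Theorems.SchneiderFree.Exact

end
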